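import Summits.QuantumFields.BalabanUV.Beta.SecondOrderBorderModelClass

/-!
# `BalabanUV.Beta.SecondOrderMixedModel` — binder row D1, (L4): **A MODEL OF THE hR MIXED SOCKET** — an explicit field–multiplier table
# satisfying the END's mixed letter at level `0` (an3's `MixedPrim`) with ZERO residual, for all four axes; its `LocStencilFM` class and
# block translation (β sub-cell, row BETA-an2 = BINDER-OWNERS row D1 OWNER, lineage an2 gen 20, K-M1)

HONEST FRAMING (cell charter, verbatim): «discharging BetaPertH makes Balaban's UV stability UNCONDITIONAL — a real
constructive-QFT result; it is NOT the continuum limit and NOT the Clay problem.»  Neutral kernel algebra ([folklore] / [our object]); no statement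
of Bałaban's papers, no `[cite:]`, no `Prop` fact; instantiates no binder of the wall BY ITSELF.  NOT D1, NOT `BetaPertH`, NOT continuum, NOT Clay.

WHAT (`d + 1 = 4`, odd `Lc`, centred root `ρ_c`, Lagrange weight `cΛ`).  The mixed letter (M₀) of the hR END (`SecondOrderLetterLevels.MixedPrim`,
K-I's hM2 at `j := 0`) reads, in the action language of `SecondOrderBorderGauge`, `actB_α M − M = Dmix_α + RM₀ α` with the FIRST-ORDER mixed contact
`Dmix_α κ u ρ′ w := conjV (cΛ • hessFFAt ρ_c Lc ρ′ w) (diagK (γ₀·ĉt^α_{κu}))`, `γ₀ = −Lc⁴∕2`.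
* §1 `Dmix`; **`actB_Dmix`**: `actB_α (Dmix_α′) = ε_α(α′) • Dmix_α′` — ODD under its own axis, EVEN under the others (an1's pure-sign law
  `hessFFAt_reflect` + the generator law `ctGen_fref`); hence the cocycle identity is trivial and
* §2 **`Mmodel Lc cΛ := −½ • (Dmix 0 + Dmix 1 + Dmix 2 + Dmix 3)`** solves ALL FOUR axes EXACTLY: `Mmodel_solves : actB_α Mmodel − Mmodel = Dmix_α`;
  **`mixedPrim_Mmodel : MixedPrim Lc ρ_c cΛ (Mmodel Lc cΛ) 0`** — (M₀) VERBATIM with residual `RM₀ := 0`.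
* §3 classes: `locStencilFM_Dmix`, **`locStencilFM_Mmodel`** (the END's `hmix`), `Dmix_translate`, **`Mmodel_translate`** (the END's `hmixt`).
CONSEQUENCE (K-M2, `SpineRecursiveT2AllModels`): with BOTH sockets modelled the hR END has NO letter hypothesis left.
HONEST: `Mmodel` is NOT shown to be an1's mixed table `mixFFAt` (that identification is an1's (W-LET-M₂): `mixFFAt − Mmodel` satisfies the
letter with contact `0`, i.e. is reflection-covariant up to an odd residual); 0∕4 binders.
Provenance: β sub-cell, unit beta-an2 gen 20, 2026-08-20 (v1); no existing file touched.
-/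

open Finset
open scoped BigOperators
open Literature.MathematicalPhysics.QuantumFieldTheory
open Literature.MathematicalPhysics.QuantumFieldTheory.Balaban1983to89
open Literature.MathematicalPhysics.QuantumFieldTheory.Balaban1983to89.Beta
open B12Sec2to5 (l1 l1_nonneg)
open ExpKernelCalculus (MKer Decays BiLoc comp shiftK Zl Zl_pos)
open AffineAveraging (box toSite)
open AveragingContoursRooted (ctr ctrOff ctrOff_mem_box)
open AveragingHessianKernelsRooted (hessFFAt hessFFAt_translate biLoc_hessFFAt)
open PolarizationSign (reflSign)
open KernelReflection (LegMap refK refK_apply)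
open KernelWard (biLoc_add biLoc_sub)
open StepJetData (biLoc_weaken biLoc_smul)
open ResolventReflection (bref bref_bref Φ Φ_r_inl Φ_r_inr Φ_s_inl Φ_s_inr reflSign_mul_self reflSign_self reflSign_of_ne)
open RootedKernelReflection (hessFFAt_reflect)
open OneStepResolventKernel (Fib LocStencil biLoc_mono)
open SecondOrderResponse (LocStencilFM)
open Summit.QuantumFields.BalabanUV.Beta.TameKernelCalculus
open Summit.QuantumFields.BalabanUV.Beta.ChartConjugation (conjV)
open Summit.QuantumFields.BalabanUV.Beta.BorderedHessian (diagK ctGen conjV_diagK_apply)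
open Summit.QuantumFields.BalabanUV.Beta.E3LevelOneReflection (refK_smul refK_Φ_refK_Φ Φ_r_r)
open Summit.QuantumFields.BalabanUV.Beta.SpineRecursivePureParity (locStencil_diagK_smul_ctGen)
open Summit.QuantumFields.BalabanUV.Beta.SecondOrderBorderGauge
open Summit.QuantumFields.BalabanUV.Beta.SecondOrderBorderGaugeWall (ctGen_fref)
open Summit.QuantumFields.BalabanUV.Beta.SecondOrderBorderCocycle
open Summit.QuantumFields.BalabanUV.Beta.SecondOrderBorderClassKit (biLoc_comp_far_left biLoc_comp_far_right biLoc_sub')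
open Summit.QuantumFields.BalabanUV.Beta.SecondOrderBorderModelClass (ctGen_add_zsmul)
open Summit.QuantumFields.BalabanUV.Beta.SecondOrderLetterLevels (MixedPrim)

namespace Summit.QuantumFields.BalabanUV.Beta.SecondOrderMixedModel

noncomputable section

section Wall

variable {Lc : ℕ} [NeZero Lc]

/-! ## §1 The first-order mixed contact and its reflection law -/

/-- [our object] **THE FIRST-ORDER MIXED CONTACT OF AXIS `α`** (the `conjV` term of (M₀)):
`Dmix Lc cΛ α κ u ρ′ w := conjV (cΛ • hessFFAt ρ_c Lc ρ′ w) (diagK (−(Lc⁴∕2)·ctGen 3 α Lc κ u))`. -/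
def Dmix (Lc : ℕ) [NeZero Lc] (cΛ : ℝ) (α : Fin 4) : Fin 4 → (Fin 4 → ℤ) → Fin 4 → (Fin 4 → ℤ) → MKer 4 (Fib 3) :=
  fun κ u ρ' w => conjV (cΛ • hessFFAt (toSite (ctrOff 4 Lc)) Lc ρ' w) (diagK fun p c => -((Lc : ℝ) ^ 4 / 2) * ctGen 3 α Lc κ u p c)

/-- [folklore] Entries of the mixed contact: `cΛ · hessFFAt ρ′ w · Δĝ`. -/
theorem Dmix_apply (cΛ : ℝ) (α κ : Fin 4) (u : Fin 4 → ℤ) (ρ' : Fin 4) (w x z : Fin 4 → ℤ) (a b : Fib 3) :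
    Dmix Lc cΛ α κ u ρ' w x z a b = cΛ * hessFFAt (toSite (ctrOff 4 Lc)) Lc ρ' w x z a b *
      (-((Lc : ℝ) ^ 4 / 2) * ctGen 3 α Lc κ u z b - -((Lc : ℝ) ^ 4 / 2) * ctGen 3 α Lc κ u x a) := by
  show conjV _ _ x z a b = _
  rw [conjV_diagK_apply, Pi.smul_apply, Pi.smul_apply, Pi.smul_apply, Pi.smul_apply, smul_eq_mul]

omit [NeZero Lc] in
/-- [folklore] The constraint Hessian at the centred root in action form, entrywise: `ε_ρ′ · s_a s_b · hessFFAt ρ′ (bref w) (r_a x) (r_b z) = hessFFAt ρ′ w x z`. -/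
theorem hessFFAt_act_apply (hLc : Odd Lc) (α ρ' : Fin 4) (w x z : Fin 4 → ℤ) (a b : Fib 3) :
    reflSign α ρ' * ((Φ (d := 3) Lc α).s a * (Φ (d := 3) Lc α).s b *
      hessFFAt (toSite (ctrOff 4 Lc)) Lc ρ' (bref α ρ' w) ((Φ (d := 3) Lc α).r a x) ((Φ (d := 3) Lc α).r b z) a b) =
      hessFFAt (toSite (ctrOff 4 Lc)) Lc ρ' w x z a b := by
  have h := hessFFAt_reflect (n := 3) hLc Lc α ρ' w
  rw [show (ctr (3 + 1) Lc : Fin 4 → ℤ) = toSite (ctrOff 4 Lc) from rfl] at h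
  have e := congrFun (congrFun (congrFun (congrFun h ((Φ (d := 3) Lc α).r a x)) ((Φ (d := 3) Lc α).r b z)) a) b
  rw [Pi.smul_apply, Pi.smul_apply, Pi.smul_apply, Pi.smul_apply, smul_eq_mul, refK_apply, Φ_r_r, Φ_r_r] at e
  rw [e]
  have h1 := reflSign_mul_self α ρ'
  have h2 := (Φ (d := 3) Lc α).s_mul_s a
  have h3 := (Φ (d := 3) Lc α).s_mul_s b
  set H := hessFFAt (toSite (ctrOff 4 Lc)) Lc ρ' w x z a b
  linear_combination (H * ((Φ (d := 3) Lc α).s a * (Φ (d := 3) Lc α).s a) * ((Φ (d := 3) Lc α).s b * (Φ (d := 3) Lc α).s b)) * h1 +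
    (H * ((Φ (d := 3) Lc α).s b * (Φ (d := 3) Lc α).s b)) * h2 + H * h3

/-- [folklore] **THE REFLECTION LAW OF THE MIXED CONTACT**: `actB_α (Dmix_α′) = ε_α(α′) • Dmix_α′` — odd under its own axis, even under the others. -/
theorem actB_Dmix (hLc : Odd Lc) (cΛ : ℝ) (α α' : Fin 4) : actB Lc α (Dmix Lc cΛ α') = reflSign α α' • Dmix Lc cΛ α' := by
  funext κ u ρ' w x z a b
  have eR : (reflSign α α' • Dmix Lc cΛ α') κ u ρ' w x z a b = reflSign α α' * Dmix Lc cΛ α' κ u ρ' w x z a b := by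
    simp only [Pi.smul_apply, smul_eq_mul]
  rw [eR, actB_apply, Dmix_apply, Dmix_apply, ctGen_fref hLc, ctGen_fref hLc, ← hessFFAt_act_apply hLc α ρ' w x z a b]
  have hκ := reflSign_mul_self α κ
  set H := hessFFAt (toSite (ctrOff 4 Lc)) Lc ρ' (bref α ρ' w) ((Φ (d := 3) Lc α).r a x) ((Φ (d := 3) Lc α).r b z) a b
  linear_combination (reflSign α ρ' * ((Φ (d := 3) Lc α).s a * (Φ (d := 3) Lc α).s b) * (cΛ * H) * reflSign α α' *
    (-((Lc : ℝ) ^ 4 / 2) * ctGen 3 α' Lc κ u z b - -((Lc : ℝ) ^ 4 / 2) * ctGen 3 α' Lc κ u x a)) * hκ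

/-! ## §2 The model mixed table -/

/-- [our object] **THE MODEL MIXED TABLE** `Mmodel Lc cΛ := −½ • (Dmix 0 + Dmix 1 + Dmix 2 + Dmix 3)`. -/
def Mmodel (Lc : ℕ) [NeZero Lc] (cΛ : ℝ) : Fin 4 → (Fin 4 → ℤ) → Fin 4 → (Fin 4 → ℤ) → MKer 4 (Fib 3) :=
  (-(1 / 2 : ℝ)) • (Dmix Lc cΛ 0 + Dmix Lc cΛ 1 + Dmix Lc cΛ 2 + Dmix Lc cΛ 3)

/-- [folklore] **`Mmodel` SOLVES ALL FOUR AXES EXACTLY**: `actB_α Mmodel − Mmodel = Dmix_α`. -/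
theorem Mmodel_solves (hLc : Odd Lc) (cΛ : ℝ) (α : Fin 4) : actB Lc α (Mmodel Lc cΛ) - Mmodel Lc cΛ = Dmix Lc cΛ α := by
  unfold Mmodel
  rw [actB_smul, actB_add, actB_add, actB_add, actB_Dmix hLc, actB_Dmix hLc, actB_Dmix hLc, actB_Dmix hLc]
  have hα : α = 0 ∨ α = 1 ∨ α = 2 ∨ α = 3 := by fin_cases α <;> simp
  rcases hα with rfl | rfl | rfl | rfl
  · rw [reflSign_self, reflSign_of_ne (by decide : (1 : Fin 4) ≠ 0), reflSign_of_ne (by decide : (2 : Fin 4) ≠ 0),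
      reflSign_of_ne (by decide : (3 : Fin 4) ≠ 0)]
    module
  · rw [reflSign_self, reflSign_of_ne (by decide : (0 : Fin 4) ≠ 1), reflSign_of_ne (by decide : (2 : Fin 4) ≠ 1),
      reflSign_of_ne (by decide : (3 : Fin 4) ≠ 1)]
    module
  · rw [reflSign_self, reflSign_of_ne (by decide : (0 : Fin 4) ≠ 2), reflSign_of_ne (by decide : (1 : Fin 4) ≠ 2),
      reflSign_of_ne (by decide : (3 : Fin 4) ≠ 2)]
    module
  · rw [reflSign_self, reflSign_of_ne (by decide : (0 : Fin 4) ≠ 3), reflSign_of_ne (by decide : (1 : Fin 4) ≠ 3),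
      reflSign_of_ne (by decide : (2 : Fin 4) ≠ 3)]
    module

/-- [folklore] **THE MODEL SATISFIES THE MIXED IDENTITY (M₀) WITH ZERO RESIDUAL** (an3's `MixedPrim`, K-I's hM2 at `j := 0`, VERBATIM). -/
theorem mixedPrim_Mmodel (hLc : Odd Lc) (cΛ : ℝ) : MixedPrim Lc (toSite (ctrOff 4 Lc)) cΛ (Mmodel Lc cΛ) (fun _ _ _ _ _ => 0) := by
  intro α κ u ρ' w
  have hsol := Mmodel_solves hLc cΛ α
  have e := congrFun (congrFun (congrFun (congrFun hsol κ) u) ρ') w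
  simp only [Pi.sub_apply] at e
  funext x z a b
  have h2 := (letter_iff_actB Lc α (Mmodel Lc cΛ) (Dmix Lc cΛ α) κ u ρ' w a b).2 (fun x z => by rw [e]) x z
  rw [add_zero]
  exact h2

/-! ## §3 Classes: `LocStencilFM` and block translation -/

/-- [folklore] `Dmix_α` is a `LocStencilFM` family (rate `1/4`; `hessFFAt` at the coarse point, the generator at the fine bond). -/
theorem locStencilFM_Dmix (hLc : Odd Lc) (cΛ : ℝ) (α : Fin 4) : ∃ C : ℝ, LocStencilFM Lc (Dmix Lc cΛ α) C (1 / 4) := by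
  have hX := locStencil_diagK_smul_ctGen (d := 3) (Lc := Lc) (-((Lc : ℝ) ^ 4 / 2)) α (zero_le_one)
  exact ⟨_, fun κ u ρ' w => by
    have hM := biLoc_smul (biLoc_hessFFAt (d := 3) hLc.pos ρ' w (ctrOff_mem_box hLc.pos) zero_le_one) cΛ
    have h1 := biLoc_comp_far_left hM (hX κ u) one_pos
    have h2 := biLoc_comp_far_right (hX κ u) hM one_pos
    have h := biLoc_sub' h1 h2
    rw [← OneStepKernelFamily.l1_neg_eq ((Lc : ℤ) • w - u), neg_sub] at h
    exact h⟩

/-- [folklore] **THE MODEL MIXED TABLE IS A `LocStencilFM` FAMILY** (the END's `hmix`). -/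
theorem locStencilFM_Mmodel (hLc : Odd Lc) (cΛ : ℝ) : ∃ C δ : ℝ, 0 < δ ∧ LocStencilFM Lc (Mmodel Lc cΛ) C δ := by
  obtain ⟨C0, h0⟩ := locStencilFM_Dmix hLc cΛ 0
  obtain ⟨C1, h1⟩ := locStencilFM_Dmix hLc cΛ 1
  obtain ⟨C2, h2⟩ := locStencilFM_Dmix hLc cΛ 2
  obtain ⟨C3, h3⟩ := locStencilFM_Dmix hLc cΛ 3
  refine ⟨|(-(1 / 2 : ℝ))| * (C0 + C1 + C2 + C3), 1 / 4, by norm_num, fun κ u ρ' w => ?_⟩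
  have h := biLoc_smul (biLoc_add (biLoc_add (biLoc_add (h0 κ u ρ' w) (h1 κ u ρ' w)) (h2 κ u ρ' w)) (h3 κ u ρ' w)) (-(1 / 2 : ℝ))
  refine biLoc_weaken (K := Mmodel Lc cΛ κ u ρ' w) h (le_of_eq (by ring)) le_rfl

/-- [folklore] `Dmix_α` is block-translation covariant (coarse slot by `t`, fine slot by `Lc•t`). -/
theorem Dmix_translate (hLc : Odd Lc) (cΛ : ℝ) (α κ : Fin 4) (u : Fin 4 → ℤ) (μ : Fin 4) (w t : Fin 4 → ℤ) :
    Dmix Lc cΛ α κ (u + (Lc : ℤ) • t) μ (w + t) = shiftK (-((Lc : ℤ) • t)) (Dmix Lc cΛ α κ u μ w) := by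
  have hH := hessFFAt_translate (toSite (ctrOff 4 Lc)) (L := Lc) μ w t
  funext x z a b
  simp only [ExpKernelCalculus.shiftK, Dmix_apply]
  rw [hH]
  simp only [ExpKernelCalculus.shiftK]
  rw [show z = (z + -((Lc : ℤ) • t)) + (Lc : ℤ) • t by abel, ctGen_add_zsmul hLc.pos,
    show x = (x + -((Lc : ℤ) • t)) + (Lc : ℤ) • t by abel, ctGen_add_zsmul hLc.pos]
  simp only [neg_add_cancel_right]

/-- [folklore] **THE MODEL MIXED TABLE IS BLOCK-TRANSLATION COVARIANT** (the END's `hmixt`). -/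
theorem Mmodel_translate (hLc : Odd Lc) (cΛ : ℝ) (κ : Fin 4) (u : Fin 4 → ℤ) (μ : Fin 4) (w t : Fin 4 → ℤ) :
    Mmodel Lc cΛ κ (u + (Lc : ℤ) • t) μ (w + t) = shiftK (-((Lc : ℤ) • t)) (Mmodel Lc cΛ κ u μ w) := by
  funext x z a b
  simp only [Mmodel, Pi.smul_apply, Pi.add_apply, smul_eq_mul, ExpKernelCalculus.shiftK, Dmix_translate hLc]

end Wall

end

end Summit.QuantumFields.BalabanUV.Beta.SecondOrderMixedModel
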